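import Summits.CriticalPhenomena.PercolationContinuityZ3.Theorems.PercNearOneGluingNoHeavyLowerTailMajorityGluingQCertSym3CountVec
import HarnessLib

/-!
# The orbit key read off the count CODE (type-space checker, step 3a; lane prim-rate, constants-miner 1, gen 37 → 38)

Support file for the closed crux `NoHeavyLowerTail` (stmt-CriticalPhenomena-4575), majority-gluing line.  The counting lemma (`…QCertSym3CountVec`) produces tables keyed by
the base-`Bs` CODE `cvcode Bs m i j k = Σ_x Bs^{cell i j k x}` of the Venn count vector; the checker must turn a code into the orbit key.  Here: the code is the
positional numeral of the cell counts (`cvcode_eq_sum`), its base-`Bs` digits ARE the counts when `m < Bs` (`digit_cvcode`), hence **`keyT_eq_keyOfCode`**: for indices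
`< 2^m + 1`, `keyT m i j k = keyOfCode m Bs [i = 2^m] [j = 2^m] [k = 2^m] (cvcode Bs m i j k)`.  No sorries.
-/

namespace Summit.CriticalPhenomena.PercolationContinuityZ3.Theorems

namespace HubOnly
namespace QCert

/-- Cell counts over the relays `< n` (`ccnt = ccntR m`). -/
def ccntR (n i j k v : ℕ) : ℕ := cnt n fun x => cell i j k x == v

/-- `ccnt` is `ccntR` at `n = m`. -/
theorem ccnt_eq_ccntR (m i j k v : ℕ) : ccnt m i j k v = ccntR m i j k v := rfl

/-- A cell index is `< 8`. -/
theorem cell_lt_eight (i j k x : ℕ) : cell i j k x < 8 := by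
  unfold cell; cases tb i x <;> cases tb j x <;> cases tb k x <;> decide

/-- Counting over one more relay. -/
theorem ccntR_succ (n i j k v : ℕ) : ccntR (n + 1) i j k v = ccntR n i j k v + (if cell i j k n = v then 1 else 0) := by
  unfold ccntR cnt
  rw [List.range_succ, List.filter_append, List.length_append]
  congr 1
  by_cases h : cell i j k n = v
  · simp [h]
  · simp [h]

/-- **The count code is the positional numeral of the cell counts.** -/
theorem cvcode_eq_sum (Bs i j k : ℕ) : ∀ n : ℕ, cvcode Bs n i j k = ((List.range 8).map fun v => ccntR n i j k v * Bs ^ v).sum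
  | 0 => by simp [cvcode, ccntR, cnt]
  | n + 1 => by
    rw [cvcode_succ, cvcode_eq_sum Bs i j k n]
    have hc := cell_lt_eight i j k n
    simp only [ccntR_succ, add_mul, List.sum_map_add]
    congr 1
    -- Σ_v [cell n = v]·Bs^v = Bs^{cell n}
    generalize cell i j k n = w at hc ⊢
    interval_cases w <;> simp [List.range_succ]

/-- Base-`Bs` digit `v` of `c`. -/
def digit (Bs c v : ℕ) : ℕ := c / Bs ^ v % Bs

/-- A positional numeral with small digits: the low part below position `w` is `< Bs^w`. -/
theorem low_lt (Bs : ℕ) (d : ℕ → ℕ) (hd : ∀ v, d v < Bs) : ∀ w : ℕ, ((List.range w).map fun v => d v * Bs ^ v).sum < Bs ^ w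
  | 0 => by simp
  | w + 1 => by
    rw [List.range_succ, List.map_append, List.sum_append, List.map_singleton, List.sum_singleton, pow_succ]
    have h1 := low_lt Bs d hd w
    have h2 : d w * Bs ^ w ≤ (Bs - 1) * Bs ^ w := Nat.mul_le_mul_right _ (by have := hd w; omega)
    have hB : 1 ≤ Bs := by have := hd 0; omega
    calc ((List.range w).map fun v => d v * Bs ^ v).sum + d w * Bs ^ w < Bs ^ w + (Bs - 1) * Bs ^ w := by omega
      _ = (Bs - 1 + 1) * Bs ^ w := by rw [Nat.succ_mul, Nat.add_comm]
      _ = Bs ^ w * Bs := by rw [Nat.sub_add_cancel hB, Nat.mul_comm]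

/-- A positional numeral splits at any position: `Σ_{v<a+b} d_v Bs^v = Σ_{v<a} d_v Bs^v + Bs^a · Σ_{u<b} d_{a+u} Bs^u`. -/
theorem numeral_split (Bs : ℕ) (d : ℕ → ℕ) (a b : ℕ) :
    ((List.range (a + b)).map fun v => d v * Bs ^ v).sum =
      ((List.range a).map fun v => d v * Bs ^ v).sum + Bs ^ a * ((List.range b).map fun u => d (a + u) * Bs ^ u).sum := by
  rw [List.range_add, List.map_append, List.sum_append, List.map_map, ← List.sum_map_mul_left]
  congr 1
  refine congrArg List.sum (List.map_congr_left fun u _ => ?_)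
  simp only [Function.comp, pow_add]; ring

/-- **Digits of a positional numeral with small digits.** -/
theorem digit_numeral (Bs : ℕ) (d : ℕ → ℕ) (hd : ∀ v, d v < Bs) (N w : ℕ) (hw : w < N) :
    digit Bs (((List.range N).map fun v => d v * Bs ^ v).sum) w = d w := by
  have hB : 0 < Bs := by have := hd 0; omega
  obtain ⟨r, rfl⟩ : ∃ r, N = w + (1 + r) := ⟨N - w - 1, by omega⟩
  unfold digit
  rw [numeral_split Bs d w (1 + r), numeral_split Bs (fun u => d (w + u)) 1 r]
  simp only [List.range_succ, List.range_zero, List.nil_append, List.map_singleton, List.sum_singleton, pow_zero, mul_one, pow_one,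
    Nat.add_zero]
  rw [Nat.add_mul_div_left _ _ (Nat.pow_pos hB), Nat.div_eq_of_lt (low_lt Bs d hd w), zero_add, Nat.add_mul_mod_self_left]
  exact Nat.mod_eq_of_lt (hd w)

/-- Cell counts over `n` relays are `≤ n`. -/
theorem ccntR_le (n i j k v : ℕ) : ccntR n i j k v ≤ n := by
  unfold ccntR cnt
  calc ((List.range n).filter _).length ≤ (List.range n).length := List.length_filter_le _ _
    _ = n := List.length_range

/-- **The digits of the count code are the cell counts** (`m < Bs`). -/
theorem digit_cvcode (Bs m i j k v : ℕ) (hB : m < Bs) (hv : v < 8) : digit Bs (cvcode Bs m i j k) v = ccnt m i j k v := by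
  rw [cvcode_eq_sum, ccnt_eq_ccntR]
  exact digit_numeral Bs (fun v => ccntR m i j k v) (fun v => lt_of_le_of_lt (ccntR_le m i j k v) hB) 8 v hv

/-- **The orbit key read off a count code** (checker side). -/
def keyOfCode (m Bs : ℕ) (di dj dk : Bool) (c : ℕ) : ℕ :=
  keyOfCounts m di dj dk (digit Bs c 1) (digit Bs c 2) (digit Bs c 3) (digit Bs c 4) (digit Bs c 5) (digit Bs c 6) (digit Bs c 7)

/-- **`keyT` from the count code**: indices `< 2^m + 1`, base `Bs > m`. -/
theorem keyT_eq_keyOfCode (m Bs i j k : ℕ) (hB : m < Bs) (hi : i < 2 ^ m + 1) (hj : j < 2 ^ m + 1) (hk : k < 2 ^ m + 1) :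
    keyT m i j k = keyOfCode m Bs (i == 2 ^ m) (j == 2 ^ m) (k == 2 ^ m) (cvcode Bs m i j k) := by
  unfold keyOfCode
  simp only [digit_cvcode Bs m i j k _ hB (by norm_num : (1:ℕ) < 8), digit_cvcode Bs m i j k _ hB (by norm_num : (2:ℕ) < 8),
    digit_cvcode Bs m i j k _ hB (by norm_num : (3:ℕ) < 8), digit_cvcode Bs m i j k _ hB (by norm_num : (4:ℕ) < 8),
    digit_cvcode Bs m i j k _ hB (by norm_num : (5:ℕ) < 8), digit_cvcode Bs m i j k _ hB (by norm_num : (6:ℕ) < 8),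
    digit_cvcode Bs m i j k _ hB (by norm_num : (7:ℕ) < 8)]
  exact keyT_eq_keyOfCounts m i j k hi hj hk

/-- Sanity (kernel): `m = 3`, `Bs = 4`. -/
theorem keyOfCode_example : keyT 3 5 3 6 = keyOfCode 3 4 false false false (cvcode 4 3 5 3 6) := by decide +kernel

end QCert
end HubOnly

end Summit.CriticalPhenomena.PercolationContinuityZ3.Theorems
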